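import Summits.Ventures.PercRepro.K4eMatroid
import Summits.Ventures.PercRepro.K4eLadderBase
import Summits.Ventures.PercRepro.K4LadderBridge
import Summits.Ventures.PercRepro.BlockSumBaseLayerLow

/-!
# PercRepro — C-025 on `T_p(M(K₄ ∖ e) ⊕ U_{m,m})`: the matroid bridge (p9, gen 14; local draft)

The second K-block family by the generic method: the block `M(K₄ ∖ e)` (`K4eMatroid`) transported along any
`e : Fin 5 ↪ α`, its profile table, the base-layer inequality of `K4eLadderBase` in profile form (`k4e_profile_ineq`,
every level `q ≥ 3`), and `rls_blockFree_of_baseLayer_three` (the levels `q ≤ 2` by the tree's theorems for every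
matroid): **`rls_k4eLadder`** = C-025 on `T_p(M(K₄ ∖ e) ⊕ U_{m,m})` for every level `q`, every `p ≥ q + 2` and every
`m ≥ p + q − 3`. Nothing here is about any window of S4.
-/

namespace PercRepro.K4eLadder

open Set Finset PercRepro.LineLadder PercRepro.K4Ladder

/-- **The `K₄ ∖ e` inequality in profile form** at the base layer `m = p + q − 3`, every level `q ≥ 3`. -/
theorem k4e_profile_ineq (p q : ℕ) (hq : 3 ≤ q) (hpq : q + 2 ≤ p) :
    phiK p q * (((if 3 ≤ q then (p + q - 3).choose (q - 3) else 0)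
        + 5 * (if 3 ≤ q then (p + q - 3).choose (q - 3) else 0)
        + 4 * (if 2 ≤ q then (p + q - 3).choose (q - 2) else 0)
        + 8 * (if 3 ≤ q then (p + q - 3).choose (q - 3) else 0)
        + 8 * (if 2 ≤ q then (p + q - 3).choose (q - 2) else 0)
        + 5 * (if 1 ≤ q then (p + q - 3).choose (q - 1) else 0)
        + (if 0 ≤ q then (p + q - 3).choose (q - 0) else 0) : ℕ) : ℚ)
      ≤ ((∑ a ∈ Ico (q + 1) p, (p + q - 3).choose a + 5 * ∑ a ∈ Ico q (p - 1), (p + q - 3).choose a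
        + 4 * ∑ a ∈ Ico (q - 1) (p - 2), (p + q - 3).choose a + 8 * ∑ a ∈ Ico (q - 1) (p - 2), (p + q - 3).choose a
        + 8 * ∑ a ∈ Ico (q - 2) (p - 3), (p + q - 3).choose a + 5 * ∑ a ∈ Ico (q - 2) (p - 3), (p + q - 3).choose a
        + ∑ a ∈ Ico (q - 2) (p - 3), (p + q - 3).choose a : ℕ) : ℚ) := by
  obtain ⟨r, rfl⟩ : ∃ r, q = r + 3 := ⟨q - 3, by omega⟩
  obtain ⟨s, rfl⟩ : ∃ s, p = r + s + 5 := ⟨p - r - 5, by omega⟩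
  have h := k4e_base r s
  rw [if_pos (by omega : 3 ≤ r + 3), if_pos (by omega : 2 ≤ r + 3), if_pos (by omega : 1 ≤ r + 3),
    if_pos (Nat.zero_le (r + 3)), show r + s + 5 + (r + 3) - 3 = 2 * r + s + 5 by omega, Nat.sub_zero]
  have eU : ((2 * r + s + 5).choose (r + 3 - 3) + 5 * (2 * r + s + 5).choose (r + 3 - 3)
      + 4 * (2 * r + s + 5).choose (r + 3 - 2) + 8 * (2 * r + s + 5).choose (r + 3 - 3)
      + 8 * (2 * r + s + 5).choose (r + 3 - 2) + 5 * (2 * r + s + 5).choose (r + 3 - 1)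
      + (2 * r + s + 5).choose (r + 3) : ℕ)
      = 14 * (2 * r + s + 5).choose (r + 3 - 3) + 12 * (2 * r + s + 5).choose (r + 3 - 2)
        + 5 * (2 * r + s + 5).choose (r + 3 - 1) + (2 * r + s + 5).choose (r + 3) := by ring
  have eY : (∑ a ∈ Ico (r + 3 + 1) (r + s + 5), (2 * r + s + 5).choose a
      + 5 * ∑ a ∈ Ico (r + 3) (r + s + 5 - 1), (2 * r + s + 5).choose a
      + 4 * ∑ a ∈ Ico (r + 3 - 1) (r + s + 5 - 2), (2 * r + s + 5).choose a
      + 8 * ∑ a ∈ Ico (r + 3 - 1) (r + s + 5 - 2), (2 * r + s + 5).choose a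
      + 8 * ∑ a ∈ Ico (r + 3 - 2) (r + s + 5 - 3), (2 * r + s + 5).choose a
      + 5 * ∑ a ∈ Ico (r + 3 - 2) (r + s + 5 - 3), (2 * r + s + 5).choose a
      + ∑ a ∈ Ico (r + 3 - 2) (r + s + 5 - 3), (2 * r + s + 5).choose a : ℕ)
      = ∑ a ∈ Ico (r + 3 + 1) (r + s + 5), (2 * r + s + 5).choose a
        + 5 * ∑ a ∈ Ico (r + 3) (r + s + 5 - 1), (2 * r + s + 5).choose a
        + 12 * ∑ a ∈ Ico (r + 3 - 1) (r + s + 5 - 2), (2 * r + s + 5).choose a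
        + 14 * ∑ a ∈ Ico (r + 3 - 2) (r + s + 5 - 3), (2 * r + s + 5).choose a := by ring
  rw [eU, eY]
  exact h

variable {α : Type}

/-- `M(K₄ ∖ e)` on any five points of `α` is finite. -/
theorem mapK4e_finite (e : Fin 5 ↪ α) : (K4e.mapEmbedding e).Finite :=
  ⟨by rw [Matroid.mapEmbedding_ground_eq]; exact Set.finite_univ.image _⟩

/-- The ground set of the transported `M(K₄ ∖ e)` is the range of the embedding. -/
theorem mapK4e_ground (e : Fin 5 ↪ α) : (K4e.mapEmbedding e).E = Set.range e := by
  rw [Matroid.mapEmbedding_ground_eq, K4e_ground, Set.image_univ]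

/-- The rank function of the transported `M(K₄ ∖ e)` on the image of an edge set. -/
theorem mapK4e_eRk (e : Fin 5 ↪ α) (X : Finset (Fin 5)) :
    (K4e.mapEmbedding e).eRk (e '' (↑X : Set (Fin 5))) = (rk X : ℕ∞) := by
  rw [Matroid.mapEmbedding, Matroid.eRk_map K4e e.injective.injOn (Set.subset_univ _), eRk_coe]

/-- The rank of the complement of the image of an edge set. -/
theorem mapK4e_eRk_compl (e : Fin 5 ↪ α) (X : Finset (Fin 5)) :
    (K4e.mapEmbedding e).eRk ((K4e.mapEmbedding e).E \ e '' (↑X : Set (Fin 5))) = (rk Xᶜ : ℕ∞) := by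
  rw [mapK4e_ground, ← Set.image_univ, ← Set.image_sdiff e.injective, ← Set.compl_eq_univ_sdiff,
    ← Finset.coe_compl, mapK4e_eRk]

/-- The subsets of the ground set of the transported `M(K₄ ∖ e)` are the images of the 32 edge sets. -/
theorem finite_subsets_eq (e : Fin 5 ↪ α) :
    (mapK4e_finite e).ground_finite.finite_subsets.toFinset
      = (univ : Finset (Finset (Fin 5))).image (fun X : Finset (Fin 5) => e '' (↑X : Set (Fin 5))) := by
  ext T
  rw [Set.Finite.mem_toFinset, Set.mem_setOf_eq, Finset.mem_image, mapK4e_ground]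
  constructor
  · intro hT
    refine ⟨(Set.toFinite (e ⁻¹' T)).toFinset, Finset.mem_univ _, ?_⟩
    rw [Set.Finite.coe_toFinset, Set.image_preimage_eq_of_subset hT]
  · rintro ⟨X, -, rfl⟩
    exact Set.image_subset_range _ _

/-- `X ↦ e '' ↑X` is injective on edge sets. -/
theorem image_coe_injective (e : Fin 5 ↪ α) :
    Function.Injective (fun X : Finset (Fin 5) => e '' (↑X : Set (Fin 5))) := fun _ _ h =>
  Finset.coe_injective ((Set.image_injective.2 e.injective) h)

/-- **C-025 ON `T_p(M(K₄ ∖ e) ⊕ U_{m,m})`** for `M(K₄ ∖ e)` on five points of `α`, `F` any finite set of `m` further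
points, every level `q`, every `p ≥ q + 2` and every `m ≥ p + q − 3` (every corank `≥ q + 2`). -/
theorem rls_k4eLadder (e : Fin 5 ↪ α) {F : Set α} (hF : F.Finite)
    (hEF : Disjoint (K4e.mapEmbedding e).E (Matroid.freeOn F).E) {m p q : ℕ} (hFm : F.ncard = m)
    (hpq : q + 2 ≤ p) (hm : p + q - 3 ≤ m) :
    @ThmN.RLS α (@PercRepro.Matroid.truncate α ((K4e.mapEmbedding e).disjointSum (Matroid.freeOn F) hEF)
        (@blockFree_finite α _ (mapK4e_finite e) F hF hEF) p)
      (@PercRepro.Matroid.truncate_finite α _ (@blockFree_finite α _ (mapK4e_finite e) F hF hEF) p) p q := by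
  haveI := mapK4e_finite e
  refine rls_blockFree_of_baseLayer_three (K4e.mapEmbedding e) 3 ?_ ?_ q hF hEF p hpq (by omega)
  · intro X hX
    rw [mapK4e_ground] at hX
    obtain ⟨X', rfl⟩ : ∃ X' : Finset (Fin 5), e '' (↑X' : Set (Fin 5)) = X :=
      ⟨(Set.toFinite (e ⁻¹' X)).toFinset, by rw [Set.Finite.coe_toFinset, Set.image_preimage_eq_of_subset hX]⟩
    rw [mapK4e_eRk, mapK4e_eRk_compl]
    simp only [ENat.toNat_coe]
    exact three_le_rk_add_rk_compl X'
  · intro p q hq hpq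
    rw [finite_subsets_eq, Finset.sum_image (fun _ _ _ _ h => image_coe_injective e h),
      Finset.sum_image (fun _ _ _ _ h => image_coe_injective e h)]
    simp only [mapK4e_eRk, mapK4e_eRk_compl, ENat.toNat_coe]
    show phiK p q * ((∑ x : Finset (Fin 5), orbU p q (p + q - 3) (profile x) : ℕ) : ℚ)
      ≤ ((∑ x : Finset (Fin 5), orbY p q (p + q - 3) (profile x) : ℕ) : ℚ)
    rw [sum_profile (orbU p q (p + q - 3)), sum_profile (orbY p q (p + q - 3))]
    simp only [orbU, orbY]
    have hqp : q < p := by omega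
    rw [orbit_sum_U p q (p + q - 3) 0 3 hqp (by omega),
      orbit_sum_U p q (p + q - 3) 1 3 hqp (by omega),
      orbit_sum_U p q (p + q - 3) 2 2 hqp (by omega),
      orbit_sum_U p q (p + q - 3) 2 3 hqp (by omega),
      orbit_sum_U p q (p + q - 3) 3 2 hqp (by omega),
      orbit_sum_U p q (p + q - 3) 3 1 hqp (by omega),
      orbit_sum_U p q (p + q - 3) 3 0 hqp (by omega),
      orbit_sum_Y p q (p + q - 3) 0, orbit_sum_Y p q (p + q - 3) 1, orbit_sum_Y p q (p + q - 3) 2,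
      orbit_sum_Y p q (p + q - 3) 3]
    rw [show q + 1 - 0 = q + 1 by omega, show p - 0 = p by omega, show q + 1 - 1 = q by omega,
      show q + 1 - 2 = q - 1 by omega, show q + 1 - 3 = q - 2 by omega]
    exact k4e_profile_ineq p q hq hpq

end PercRepro.K4eLadder
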